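import Summits.PneNP.PneNP.Theorems.SoloInformedIOShape
import Literature.Computability.MetaComplexity.WitnessLevinSearch
import HarnessLib

/-!
# Solo (informed) — the summit as the Levin cost of `NP`-witnesses

`PneNP` is `∃ L ∈ NP, L ∉ P`. This file records, as kernel-checked equivalences, the reading of the
summit through **Levin's universal search** (L. A. Levin 1973; Hutter, *Universal Artificial
Intelligence*, §7.1.2; Li–Vitányi, Handbook of TCS A, ch. 4 §6): for every efficient universal
machine `U` (hypothesis structure `UniversalMachine`; the tree's fixed instance is `stdU`), measure
the *conditional Levin cost* of a witness `y` of an instance `x` by the length `|π|` of a program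
with `U(⟨π, x⟩) = y` and its running time `t` (`Kt(y | x) = min (|π| + log t)`). Then

* `soloInformed_pneNP_iff_exists_costly_witnesses` — **`P ≠ NP` iff some `NP` search problem
  (`R ∈ P`, bound `p`) has, for every `c`, a positive instance `x` none of whose witnesses is
  produced by a program of length `≤ c log₂|x| + c` within `|x|^c + c` steps** (all witnesses of
  `x` have Levin cost beyond `c log|x|`); equivalently (`P = NP` side) iff every `NP` search
  problem has witnesses of logarithmic Levin cost, found by Levin's search in polynomial time;
* `soloInformed_pneNP_iff_sat_costly_witnesses` — the same for `SAT` alone, with respect to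
  every verifier presentation `(R, p)` of `SAT` (Cook–Levin);
* `soloInformed_pneNP_iff_costly_witnesses_stdU` — the instance at the tree's fixed machine `stdU`.

Like the other solo margins this is an `∃∀`/`∀∃` statement *equivalent* to the summit, not a
weakening: its value is precision about WHAT must be shown hard — not deciding, but the
information content (relative to the instance, under time bounds) of every certificate.
Two-line consequences of `Literature.Computability.MetaComplexity.not_NP_subset_P_iff_exists_costly_witnesses`,
`mem_P_of_logCost_witnesses`, `exists_logCost_witnesses_of_NP_subset_P` and the solo I/O-shape
lemma `soloInformed_pneNP_iff_exists_not_mem`.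
-/

namespace Summit.PneNP.PneNP.Theorems

open Literature.Computability.Complexity Literature.Computability.Cryptography
  Literature.Computability.MetaComplexity _root_.Computability

/-- **`P ≠ NP` iff some `NP` search problem has necessarily costly witnesses** (for every
efficient universal machine `U`): there are `R ∈ P` and a bound `p` such that for every `c` some
instance `x` has a witness but no program of length `≤ c log₂|x| + c` outputs a witness of `x`
within `|x|^c + c` steps. [cite: Levin1973, (universal search)]
[cite: Hutter2005, Sect. 7.1.2 (Levin search; held book:hutter2006-universal-artificial-intelligence-sequential-decisions-based-algorith p0400)]
[cite: LiVitanyi1990, Sect. 6 (Levin's Kt; held book:luisand-algorithms-complexity p0302)] -/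
theorem soloInformed_pneNP_iff_exists_costly_witnesses (U : UniversalMachine) :
    PneNP ↔ ∃ R ∈ Classes.P, ∃ p : Polynomial ℕ, ∀ c : ℕ, ∃ x : List Bool,
      (∃ y : List Bool, y.length ≤ p.eval x.length ∧ boolPair x y ∈ R) ∧
        ∀ (π y : List Bool) (t : ℕ), π.length ≤ c * Nat.log 2 x.length + c →
          t ≤ x.length ^ c + c → U.run (boolPair π x) t = some y →
            ¬ (y.length ≤ p.eval x.length ∧ boolPair x y ∈ R) := by
  rw [soloInformed_pneNP_iff_exists_not_mem, ← not_NP_subset_P_iff_exists_costly_witnesses U,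
    Set.not_subset]

/-- **`P ≠ NP` iff `SAT` has necessarily costly witnesses**: for every verifier presentation
`(R, p)` of `SAT` (`R ∈ P`, `x ∈ SAT ↔ ∃ y, |y| ≤ p(|x|) ∧ ⟨x, y⟩ ∈ R`) and every `c`, some
satisfiable `x` has no `R`-witness produced by a program of length `≤ c log₂|x| + c` within
`|x|^c + c` steps (`⇐`: else Levin's search decides `SAT` and Cook–Levin gives `NP ⊆ P`).
[cite: Levin1973, (universal search)] [cite: AroraBarak2009, Thm. 2.10 (Cook–Levin)] -/
theorem soloInformed_pneNP_iff_sat_costly_witnesses (U : UniversalMachine) :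
    PneNP ↔ ∀ R ∈ Classes.P, ∀ p : Polynomial ℕ, IsPolyVerifierFor R p SAT → ∀ c : ℕ,
      ∃ x ∈ SAT, ∀ (π y : List Bool) (t : ℕ), π.length ≤ c * Nat.log 2 x.length + c →
        t ≤ x.length ^ c + c → U.run (boolPair π x) t = some y →
          ¬ (y.length ≤ p.eval x.length ∧ boolPair x y ∈ R) := by
  have hSAT : IsNPComplete SAT := isNPComplete_SAT_holds
  rw [soloInformed_pneNP_iff_exists_not_mem]
  constructor
  · rintro ⟨L, hL, hLP⟩ R hR p hver c
    by_contra h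
    push Not at h
    have hSATP : SAT ∈ Classes.P :=
      mem_P_of_logCost_witnesses U hR hver (c := c) fun x hx => by
        obtain ⟨π, y, t, hπ, ht, hrun, hy⟩ := h x hx
        exact ⟨π, y, t, hπ, ht, hrun, hy.1, hy.2⟩
    exact hLP (NP_subset_P_of_isNPComplete_of_mem_P hSAT hSATP hL)
  · intro h
    refine ⟨SAT, hSAT.1, fun hSATP => ?_⟩
    have hNP : Nondeterministic.NP ⊆ Classes.P := NP_subset_P_of_isNPComplete_of_mem_P hSAT hSATP
    obtain ⟨R, hR, p, hver⟩ := hSAT.1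
    obtain ⟨c, hc⟩ := exists_logCost_witnesses_of_NP_subset_P U hNP hR p
    obtain ⟨x, hx, hno⟩ := h R hR p hver c
    obtain ⟨π, y, t, hπ, ht, hrun, hy, hyR⟩ := hc x ((hver x).1 hx)
    exact hno π y t hπ ht hrun ⟨hy, hyR⟩

/-- **The summit at the tree's fixed universal machine `stdU`**: `P ≠ NP` iff some `NP` search
problem has, for every `c`, a positive instance all of whose witnesses cost more than
`(c log₂|x| + c, |x|^c + c)` on `stdU`. [cite: Levin1973, (universal search)]
[cite: Hutter2005, Sect. 7.1.2 (Levin search)] -/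
theorem soloInformed_pneNP_iff_costly_witnesses_stdU :
    PneNP ↔ ∃ R ∈ Classes.P, ∃ p : Polynomial ℕ, ∀ c : ℕ, ∃ x : List Bool,
      (∃ y : List Bool, y.length ≤ p.eval x.length ∧ boolPair x y ∈ R) ∧
        ∀ (π y : List Bool) (t : ℕ), π.length ≤ c * Nat.log 2 x.length + c →
          t ≤ x.length ^ c + c → stdU.run (boolPair π x) t = some y →
            ¬ (y.length ≤ p.eval x.length ∧ boolPair x y ∈ R) :=
  soloInformed_pneNP_iff_exists_costly_witnesses stdU

end Summit.PneNP.PneNP.Theorems
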